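import Mathlib
import HarnessLib
import Literature.MathematicalPhysics.KineticTheory.VelocityFlipNoise
import Literature.MathematicalPhysics.KineticTheory.MomentumHermiteLadder
import Literature.MathematicalPhysics.KineticTheory.PhaseSpacePoisson
import Literature.MathematicalPhysics.KineticTheory.LangevinChainHormander
import Literature.MathematicalPhysics.KineticTheory.LangevinChainKalman
import Literature.Barriers.AtomisticToContinuum.MacroErgodicityHypothesis
import Summits.AtomisticToContinuum.FouriersLaw.Theorems.JunctionLocalityInsertionCalculus

/-!
# The Thomson witness of the velocity-flip pinned chain, I: block calculus
(`--supports` file for crux `VanishingNoiseTransfer.NoisyFourier`, stmt-AtomisticToContinuum-11977, line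
`abel-storage-decay`, stub B `stub_bulkAbelGKPositivity`; part W3 "WitnessAlgebra", file 1 of 3)

The Thomson witness of stub B is the explicit local function (pinned chain `pinnedChain ω₂ lam β γ`, `L` sites)
`v = Σ_{bonds (i, j = i+1)} [p_i (p_j² φ'(r) − H_j φ(r)) + p_j (p_i² φ'(r) + H_i φ(r))]`, `r = q_j − q_i`,
`φ(r) = 1/(1 + 3βr²) = 1/V''(r)`, `H_k = ∂_{q_k} H` (written inline everywhere; this file introduces no definitions).
This file is the pointwise calculus of its building blocks:
* one-variable calculus of `φ`, `φ' = −6βr/(1+3βr²)²`, `φ'' = 6β(9βr² − 1)/(1+3βr²)³` (`hasDerivAt_phi`,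
  `hasDerivAt_dphi`, smoothness for `β ≥ 0`);
* slices along one coordinate (`hasDerivAt_update_apply`, `hasDerivAt_phi_update`, `hasDerivAt_dphi_update`);
* the force and the Hessian of the pinned chain: `∂_{q_k} H = ∂Φ/∂q_k` in closed form (`partialQ_hamiltonian`,
  `partialQ_hamiltonian_explicit`), `∂_{q_l}∂_{q_k} H = ∂²Φ/∂q_l∂q_k` (`partialQ_partialQ_hamiltonian`), its
  tridiagonal entries `−V''(r)` / `ω₂ + 3 lam q² + V''(r_i)[i+1<L] + V''(r_{i−1})[1≤i]` (`hessPotential_bond`,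
  `hessPotential_diag`, `sum_mul_hessPotential`), `∂_{p_l}∂_{q_k} H = 0`;
* smoothness of the bond term and of `v` (`contDiff_bond`, `contDiff_thomsonWitness`, `contDiff_two_thomsonWitness`),
  registered as `helper_thomsonWitnessContDiffTwo`.
All statements are [folklore] calculus; axioms `propext`, `Classical.choice`, `Quot.sound` only.
-/

noncomputable section

open MeasureTheory Filter Topology
open scoped BigOperators ContDiff
open Literature.MathematicalPhysics.KineticTheory.HeatConduction
open Literature.Barriers.AtomisticToContinuum (pinnedChain_deriv_deriv_U)
open Summit.AtomisticToContinuum.FouriersLaw.Cruxes.SuperadditiveResistance.InsertionToolbox (contDiff_snd_apply)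

namespace Summit.AtomisticToContinuum.FouriersLaw.Theorems.NoisyFourier.ThomsonWitness.Algebra

variable {L : ℕ} {ω₂ lam β γ : ℝ}

/-! ### One-variable calculus of `φ = 1/V''`, `φ'`, `φ''` -/

/-- `V''(r) = 1 + 3βr² > 0` for `β ≥ 0`. [folklore] -/
theorem one_add_three_mul_sq_pos (hβ : 0 ≤ β) (r : ℝ) : 0 < 1 + 3 * β * r ^ 2 := by positivity

/-- `φ'(r) = -6βr/(1 + 3βr²)²` for `φ(r) = 1/(1 + 3βr²)`. [folklore] -/
theorem hasDerivAt_phi (hβ : 0 ≤ β) (r : ℝ) :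
    HasDerivAt (fun r : ℝ => 1 / (1 + 3 * β * r ^ 2)) (-(6 * β * r) / (1 + 3 * β * r ^ 2) ^ 2) r := by
  have hD : (1 + 3 * β * r ^ 2) ≠ 0 := (one_add_three_mul_sq_pos hβ r).ne'
  have h1 : HasDerivAt (fun r : ℝ => 1 + 3 * β * r ^ 2) (3 * β * (2 * r)) r := by
    simpa using ((hasDerivAt_pow 2 r).const_mul (3 * β)).const_add 1
  refine ((hasDerivAt_const r (1 : ℝ)).fun_div h1 hD).congr_deriv ?_
  field_simp
  ring

/-- `φ''(r) = 6β(9βr² - 1)/(1 + 3βr²)³`. [folklore] -/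
theorem hasDerivAt_dphi (hβ : 0 ≤ β) (r : ℝ) :
    HasDerivAt (fun r : ℝ => -(6 * β * r) / (1 + 3 * β * r ^ 2) ^ 2)
      (6 * β * (9 * β * r ^ 2 - 1) / (1 + 3 * β * r ^ 2) ^ 3) r := by
  have hD : (1 + 3 * β * r ^ 2) ≠ 0 := (one_add_three_mul_sq_pos hβ r).ne'
  have hD2 : (1 + 3 * β * r ^ 2) ^ 2 ≠ 0 := pow_ne_zero 2 hD
  have h1 : HasDerivAt (fun r : ℝ => 1 + 3 * β * r ^ 2) (3 * β * (2 * r)) r := by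
    simpa using ((hasDerivAt_pow 2 r).const_mul (3 * β)).const_add 1
  have h2 : HasDerivAt (fun r : ℝ => (1 + 3 * β * r ^ 2) ^ 2)
      (2 * (1 + 3 * β * r ^ 2) * (3 * β * (2 * r))) r := by
    simpa using h1.fun_pow 2
  have hn : HasDerivAt (fun r : ℝ => -(6 * β * r)) (-(6 * β * 1)) r :=
    ((hasDerivAt_id r).const_mul (6 * β)).fun_neg
  refine (hn.fun_div h2 hD2).congr_deriv ?_
  field_simp
  ring

/-- `φ = 1/(1 + 3βr²)` is smooth (`β ≥ 0`). [folklore] -/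
theorem contDiff_phi (hβ : 0 ≤ β) {n : WithTop ℕ∞} :
    ContDiff ℝ n (fun r : ℝ => 1 / (1 + 3 * β * r ^ 2)) :=
  contDiff_const.div (by fun_prop) fun r => (one_add_three_mul_sq_pos hβ r).ne'

/-- `φ' = -6βr/(1 + 3βr²)²` is smooth (`β ≥ 0`). [folklore] -/
theorem contDiff_dphi (hβ : 0 ≤ β) {n : WithTop ℕ∞} :
    ContDiff ℝ n (fun r : ℝ => -(6 * β * r) / (1 + 3 * β * r ^ 2) ^ 2) :=
  (by fun_prop : ContDiff ℝ n (fun r : ℝ => -(6 * β * r))).div (by fun_prop)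
    fun r => pow_ne_zero 2 (one_add_three_mul_sq_pos hβ r).ne'

/-- `φ'' = 6β(9βr² - 1)/(1 + 3βr²)³` is smooth (`β ≥ 0`). [folklore] -/
theorem contDiff_ddphi (hβ : 0 ≤ β) {n : WithTop ℕ∞} :
    ContDiff ℝ n (fun r : ℝ => 6 * β * (9 * β * r ^ 2 - 1) / (1 + 3 * β * r ^ 2) ^ 3) :=
  (by fun_prop : ContDiff ℝ n (fun r : ℝ => 6 * β * (9 * β * r ^ 2 - 1))).div (by fun_prop)
    fun r => pow_ne_zero 3 (one_add_three_mul_sq_pos hβ r).ne'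

/-! ### Slices along one coordinate -/

/-- `d/ds (p[l ↦ s])_m = δ_{ml}`. [folklore] -/
theorem hasDerivAt_update_apply (p : Fin L → ℝ) (l m : Fin L) (t : ℝ) :
    HasDerivAt (fun s => Function.update p l s m) (if m = l then 1 else 0) t := by
  have h := (hasDerivAt_pi.1 (hasDerivAt_update p l t)) m
  simpa [Pi.single_apply] using h

/-- `d/ds (p[l ↦ s])_m² = 2 p_m δ_{ml}` at `s = p_l`. [folklore] -/
theorem hasDerivAt_update_apply_sq (p : Fin L → ℝ) (l m : Fin L) :
    HasDerivAt (fun s => Function.update p l s m ^ 2) (if m = l then 2 * p m else 0) (p l) := by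
  refine ((hasDerivAt_update_apply p l m (p l)).fun_pow 2).congr_deriv ?_
  by_cases hm : m = l
  · subst hm; simp
  · simp [hm]

/-- The slice of `φ(q_j - q_i)` along `q_l`: derivative `φ'(r)(δ_{jl} - δ_{il})`. [folklore] -/
theorem hasDerivAt_phi_update (hβ : 0 ≤ β) (q : Fin L → ℝ) (i j l : Fin L) :
    HasDerivAt (fun t => 1 / (1 + 3 * β * (Function.update q l t j - Function.update q l t i) ^ 2))
      (-(6 * β * (q j - q i)) / (1 + 3 * β * (q j - q i) ^ 2) ^ 2 *
        ((if j = l then 1 else 0) - (if i = l then 1 else 0))) (q l) := by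
  have inner : HasDerivAt (fun t => Function.update q l t j - Function.update q l t i)
      ((if j = l then 1 else 0) - (if i = l then 1 else 0)) (q l) :=
    (hasDerivAt_update_apply q l j _).fun_sub (hasDerivAt_update_apply q l i _)
  exact (hasDerivAt_phi hβ (q j - q i)).comp_of_eq (q l) inner (by simp)

/-- The slice of `φ'(q_j - q_i)` along `q_l`: derivative `φ''(r)(δ_{jl} - δ_{il})`. [folklore] -/
theorem hasDerivAt_dphi_update (hβ : 0 ≤ β) (q : Fin L → ℝ) (i j l : Fin L) :
    HasDerivAt (fun t => -(6 * β * (Function.update q l t j - Function.update q l t i)) /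
        (1 + 3 * β * (Function.update q l t j - Function.update q l t i) ^ 2) ^ 2)
      (6 * β * (9 * β * (q j - q i) ^ 2 - 1) / (1 + 3 * β * (q j - q i) ^ 2) ^ 3 *
        ((if j = l then 1 else 0) - (if i = l then 1 else 0))) (q l) := by
  have inner : HasDerivAt (fun t => Function.update q l t j - Function.update q l t i)
      ((if j = l then 1 else 0) - (if i = l then 1 else 0)) (q l) :=
    (hasDerivAt_update_apply q l j _).fun_sub (hasDerivAt_update_apply q l i _)
  exact (hasDerivAt_dphi hβ (q j - q i)).comp_of_eq (q l) inner (by simp)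

/-! ### The pinned-chain Hamiltonian: first and second position partials -/

/-- `U` of the pinned chain is differentiable. [folklore] -/
theorem pinnedChain_differentiable_U (ω₂ lam β γ : ℝ) : Differentiable ℝ (pinnedChain ω₂ lam β γ).U :=
  (pinnedChain_contDiff_U ω₂ lam β γ (n := 1)).differentiable one_ne_zero

/-- `V` of the pinned chain is differentiable. [folklore] -/
theorem pinnedChain_differentiable_V (ω₂ lam β γ : ℝ) : Differentiable ℝ (pinnedChain ω₂ lam β γ).V :=
  (pinnedChain_contDiff_V ω₂ lam β γ (n := 1)).differentiable one_ne_zero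

/-- `U'` of the pinned chain is differentiable. [folklore] -/
theorem pinnedChain_differentiable_deriv_U (ω₂ lam β γ : ℝ) :
    Differentiable ℝ (deriv (pinnedChain ω₂ lam β γ).U) := by
  rw [show deriv (pinnedChain ω₂ lam β γ).U = fun q => ω₂ * q + lam * q ^ 3 from
    funext (pinnedChain_deriv_U ω₂ lam β γ)]
  fun_prop

/-- `V'` of the pinned chain is differentiable. [folklore] -/
theorem pinnedChain_differentiable_deriv_V (ω₂ lam β γ : ℝ) :
    Differentiable ℝ (deriv (pinnedChain ω₂ lam β γ).V) := by
  rw [show deriv (pinnedChain ω₂ lam β γ).V = fun r => r + β * r ^ 3 from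
    funext (pinnedChain_deriv_V ω₂ lam β γ)]
  fun_prop

/-- `∂_{q_k} H = ∂Φ/∂q_k (q)` (closed form `dPotential`) for the pinned chain. [folklore] -/
theorem partialQ_hamiltonian (x : PhaseSpace L) (k : Fin L) :
    partialQ k ((pinnedChain ω₂ lam β γ).hamiltonian L) x = (pinnedChain ω₂ lam β γ).dPotential L k x.1 :=
  (pinnedChain ω₂ lam β γ).partialQ_hamiltonian_eq_dPotential (pinnedChain_differentiable_U ω₂ lam β γ)
    (pinnedChain_differentiable_V ω₂ lam β γ) L x k

/-- `∂_{q_k} H` does not depend on the momenta. [folklore] -/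
theorem partialQ_hamiltonian_update_snd (x : PhaseSpace L) (k l : Fin L) (t : ℝ) :
    partialQ k ((pinnedChain ω₂ lam β γ).hamiltonian L) (x.1, Function.update x.2 l t) =
      partialQ k ((pinnedChain ω₂ lam β γ).hamiltonian L) x := by
  rw [partialQ_hamiltonian, partialQ_hamiltonian]

/-- **(a) The explicit force.** `∂_{q_k} H = ω₂ q_k + lam q_k³ - V'(q_{k+1} - q_k)[k+1 < L] + V'(q_k - q_{k-1})[1 ≤ k]`,
`V'(r) = r + βr³`, the boundary brackets written as sums over the neighbour. [folklore] -/
theorem partialQ_hamiltonian_explicit (x : PhaseSpace L) (k : Fin L) :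
    partialQ k ((pinnedChain ω₂ lam β γ).hamiltonian L) x =
      ω₂ * x.1 k + lam * x.1 k ^ 3 -
        (∑ l : Fin L, if l.val = k.val + 1 then ((x.1 l - x.1 k) + β * (x.1 l - x.1 k) ^ 3) else 0) +
        (∑ l : Fin L, if k.val = l.val + 1 then ((x.1 k - x.1 l) + β * (x.1 k - x.1 l) ^ 3) else 0) := by
  rw [partialQ_hamiltonian]
  unfold OscillatorChain.dPotential
  simp only [pinnedChain_deriv_U, pinnedChain_deriv_V]
  have key : ∀ a b : Fin L,
      (if b.val = a.val + 1 then
        (x.1 b - x.1 a + β * (x.1 b - x.1 a) ^ 3) * ((if b = k then 1 else 0) - (if a = k then 1 else 0))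
        else (0 : ℝ)) =
      (if a = k then -(if b.val = k.val + 1 then (x.1 b - x.1 k + β * (x.1 b - x.1 k) ^ 3) else 0) else 0) +
        (if b = k then (if k.val = a.val + 1 then (x.1 k - x.1 a + β * (x.1 k - x.1 a) ^ 3) else 0)
          else 0) := by
    intro a b
    split_ifs <;> subst_vars <;> (try simp only [Fin.ext_iff] at *) <;> first | (exfalso; omega) | ring
  simp_rw [key]
  simp only [Finset.sum_add_distrib, Finset.sum_ite_eq', Finset.mem_univ, if_true]
  rw [Finset.sum_comm]
  simp only [Finset.sum_ite_eq', Finset.mem_univ, if_true, Finset.sum_neg_distrib]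
  ring

/-- The slice of `∂Φ/∂q_k` along `q_l` has derivative the Hessian entry `∂²Φ/∂q_l∂q_k`. [folklore] -/
theorem hasDerivAt_dPotential_update (q : Fin L → ℝ) (k l : Fin L) :
    HasDerivAt (fun t => (pinnedChain ω₂ lam β γ).dPotential L k (Function.update q l t))
      ((pinnedChain ω₂ lam β γ).hessPotential L k l q) (q l) := by
  have h0 := (pinnedChain ω₂ lam β γ).hasDerivAt_dPotential_add_smul
    (pinnedChain_differentiable_deriv_U ω₂ lam β γ) (pinnedChain_differentiable_deriv_V ω₂ lam β γ) L q k l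
  have hfun : (fun t => (pinnedChain ω₂ lam β γ).dPotential L k (Function.update q l t)) =
      (fun s : ℝ => (pinnedChain ω₂ lam β γ).dPotential L k (q + s • Pi.single l 1)) ∘ fun t => t - q l := by
    funext t
    simp only [Function.comp_apply, add_smul_single_eq_update, add_sub_cancel]
  rw [hfun]
  have hlin : HasDerivAt (fun t : ℝ => t - q l) 1 (q l) := (hasDerivAt_id (q l)).sub_const (q l)
  simpa using h0.comp_of_eq (q l) hlin (by simp)

/-- The slice of `∂_{q_k} H` along `q_l` has derivative `∂²Φ/∂q_l∂q_k (q)`. [folklore] -/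
theorem hasDerivAt_partialQ_hamiltonian_update (x : PhaseSpace L) (k l : Fin L) :
    HasDerivAt (fun t => partialQ k ((pinnedChain ω₂ lam β γ).hamiltonian L) (Function.update x.1 l t, x.2))
      ((pinnedChain ω₂ lam β γ).hessPotential L k l x.1) (x.1 l) := by
  simp only [partialQ_hamiltonian]
  exact hasDerivAt_dPotential_update x.1 k l

/-- The slice of `∂_{q_k} H` along a momentum `p_l` is constant. [folklore] -/
theorem hasDerivAt_partialQ_hamiltonian_update_snd (x : PhaseSpace L) (k l : Fin L) (t₀ : ℝ) :
    HasDerivAt (fun t => partialQ k ((pinnedChain ω₂ lam β γ).hamiltonian L) (x.1, Function.update x.2 l t))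
      0 t₀ := by
  simp only [partialQ_hamiltonian_update_snd]
  exact hasDerivAt_const _ _

/-- **(b) Second position partials of `H` are the Hessian entries**: `∂_{q_l} ∂_{q_k} H = ∂²Φ/∂q_l∂q_k (q)`.
[folklore] -/
theorem partialQ_partialQ_hamiltonian (x : PhaseSpace L) (k l : Fin L) :
    partialQ l (partialQ k ((pinnedChain ω₂ lam β γ).hamiltonian L)) x =
      (pinnedChain ω₂ lam β γ).hessPotential L k l x.1 :=
  (hasDerivAt_partialQ_hamiltonian_update x k l).deriv

/-- `∂_{p_l} ∂_{q_k} H = 0`. [folklore] -/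
theorem partialP_partialQ_hamiltonian (x : PhaseSpace L) (k l : Fin L) :
    partialP l (partialQ k ((pinnedChain ω₂ lam β γ).hamiltonian L)) x = 0 := by
  unfold partialP
  simp only [partialQ_hamiltonian, deriv_const]

/-- `∂_{q_l} ∂_{q_k} H` does not depend on the momenta. [folklore] -/
theorem partialQ_partialQ_hamiltonian_update_snd (x : PhaseSpace L) (k l m : Fin L) (t : ℝ) :
    partialQ l (partialQ k ((pinnedChain ω₂ lam β γ).hamiltonian L)) (x.1, Function.update x.2 m t) =
      partialQ l (partialQ k ((pinnedChain ω₂ lam β γ).hamiltonian L)) x := by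
  rw [partialQ_partialQ_hamiltonian, partialQ_partialQ_hamiltonian]

/-- Off-diagonal Hessian entries of the pinned chain: `∂²Φ/∂q_i∂q_j = -V''(q_j - q_i) = -(1 + 3β(q_j - q_i)²)`
for `j = i + 1`. [folklore] -/
theorem hessPotential_bond (q : Fin L → ℝ) {i j : Fin L} (h : j.val = i.val + 1) :
    (pinnedChain ω₂ lam β γ).hessPotential L j i q = -(1 + 3 * β * (q j - q i) ^ 2) := by
  rw [(pinnedChain ω₂ lam β γ).hessPotential_succ L h, pinnedChain_deriv_deriv_V]

/-- The same entry in the other index order. [folklore] -/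
theorem hessPotential_bond' (q : Fin L → ℝ) {i j : Fin L} (h : j.val = i.val + 1) :
    (pinnedChain ω₂ lam β γ).hessPotential L i j q = -(1 + 3 * β * (q j - q i) ^ 2) := by
  rw [(pinnedChain ω₂ lam β γ).hessPotential_comm L i j q, hessPotential_bond q h]

/-- **(b) The diagonal Hessian entries of the pinned chain**:
`∂²Φ/∂q_i² = ω₂ + 3 lam q_i² + V''(q_{i+1} - q_i)[i+1 < L] + V''(q_i - q_{i-1})[1 ≤ i]`. [folklore] -/
theorem hessPotential_diag (q : Fin L → ℝ) (i : Fin L) :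
    (pinnedChain ω₂ lam β γ).hessPotential L i i q =
      ω₂ + 3 * lam * q i ^ 2 + (∑ l : Fin L, if l.val = i.val + 1 then (1 + 3 * β * (q l - q i) ^ 2) else 0) +
        (∑ l : Fin L, if i.val = l.val + 1 then (1 + 3 * β * (q i - q l) ^ 2) else 0) := by
  unfold OscillatorChain.hessPotential
  simp only [if_true, mul_one, pinnedChain_deriv_deriv_U, pinnedChain_deriv_deriv_V]
  have key : ∀ a b : Fin L,
      (if b.val = a.val + 1 then
        (1 + 3 * β * (q b - q a) ^ 2) * ((if b = i then 1 else 0) - (if a = i then 1 else 0)) *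
          ((if b = i then 1 else 0) - (if a = i then 1 else 0))
        else (0 : ℝ)) =
      (if a = i then (if b.val = i.val + 1 then (1 + 3 * β * (q b - q i) ^ 2) else 0) else 0) +
        (if b = i then (if i.val = a.val + 1 then (1 + 3 * β * (q i - q a) ^ 2) else 0) else 0) := by
    intro a b
    split_ifs <;> subst_vars <;> (try simp only [Fin.ext_iff] at *) <;> first | (exfalso; omega) | ring
  simp_rw [key]
  simp only [Finset.sum_add_distrib, Finset.sum_ite_eq', Finset.mem_univ, if_true]
  rw [Finset.sum_comm]
  simp only [Finset.sum_ite_eq', Finset.mem_univ, if_true]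
  ring

/-- The Hessian is tridiagonal: `∑_l p_l ∂²Φ/∂q_l∂q_k = p_{k-1}(·)[1 ≤ k] + p_k ∂²Φ/∂q_k² + p_{k+1}(·)[k+1 < L]`.
[folklore] -/
theorem sum_mul_hessPotential (k : Fin L) (p q : Fin L → ℝ) :
    ∑ l : Fin L, p l * (pinnedChain ω₂ lam β γ).hessPotential L k l q =
      (∑ l : Fin L, if k.val = l.val + 1 then p l * (pinnedChain ω₂ lam β γ).hessPotential L k l q else 0) +
        p k * (pinnedChain ω₂ lam β γ).hessPotential L k k q +
        (∑ l : Fin L, if l.val = k.val + 1 then p l * (pinnedChain ω₂ lam β γ).hessPotential L k l q else 0) := by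
  have key : ∀ l : Fin L, p l * (pinnedChain ω₂ lam β γ).hessPotential L k l q =
      (if k.val = l.val + 1 then p l * (pinnedChain ω₂ lam β γ).hessPotential L k l q else 0) +
        (if k = l then p l * (pinnedChain ω₂ lam β γ).hessPotential L k l q else 0) +
        (if l.val = k.val + 1 then p l * (pinnedChain ω₂ lam β γ).hessPotential L k l q else 0) := by
    intro l
    by_cases h1 : k.val = l.val + 1
    · have h2 : k ≠ l := fun e => by rw [e] at h1; omega
      have h3 : l.val ≠ k.val + 1 := by omega
      rw [if_pos h1, if_neg h2, if_neg h3, add_zero, add_zero]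
    · by_cases h2 : k = l
      · subst h2
        rw [if_neg h1, if_pos rfl]
        ring
      · by_cases h3 : l.val = k.val + 1
        · rw [if_neg h1, if_neg h2, if_pos h3, zero_add, zero_add]
        · have hfar : l.val + 2 ≤ k.val ∨ k.val + 2 ≤ l.val := by
            have : k.val ≠ l.val := fun e => h2 (Fin.ext e)
            omega
          rw [if_neg h1, if_neg h2, if_neg h3, (pinnedChain ω₂ lam β γ).hessPotential_eq_zero_of_two_le L hfar q]
          ring
  rw [Finset.sum_congr rfl fun l _ => key l]
  simp only [Finset.sum_add_distrib, Finset.sum_ite_eq, Finset.mem_univ, if_true]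

/-! ### Smoothness of the blocks and of the witness -/

/-- The position coordinate `q_m` is smooth. [folklore] -/
theorem contDiff_fst_apply (m : Fin L) {n : WithTop ℕ∞} : ContDiff ℝ n fun x : PhaseSpace L => x.1 m :=
  (contDiff_apply ℝ ℝ m).comp contDiff_fst

/-- `x ↦ ∂_{q_k} H (x)` is smooth for the pinned chain. [folklore] -/
theorem contDiff_partialQ_hamiltonian (k : Fin L) :
    ContDiff ℝ ∞ fun x : PhaseSpace L => partialQ k ((pinnedChain ω₂ lam β γ).hamiltonian L) x := by
  simp only [partialQ_hamiltonian]
  exact ((pinnedChain ω₂ lam β γ).contDiff_dPotential (pinnedChain_contDiff_U ω₂ lam β γ)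
    (pinnedChain_contDiff_V ω₂ lam β γ) L k).comp contDiff_fst

/-- `x ↦ φ(q_j - q_i)` is smooth (`β ≥ 0`). [folklore] -/
theorem contDiff_phi_coord (hβ : 0 ≤ β) (i j : Fin L) {n : WithTop ℕ∞} :
    ContDiff ℝ n fun x : PhaseSpace L => 1 / (1 + 3 * β * (x.1 j - x.1 i) ^ 2) :=
  (contDiff_phi hβ).comp ((contDiff_fst_apply j).sub (contDiff_fst_apply i))

/-- `x ↦ φ'(q_j - q_i)` is smooth (`β ≥ 0`). [folklore] -/
theorem contDiff_dphi_coord (hβ : 0 ≤ β) (i j : Fin L) {n : WithTop ℕ∞} :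
    ContDiff ℝ n fun x : PhaseSpace L => -(6 * β * (x.1 j - x.1 i)) / (1 + 3 * β * (x.1 j - x.1 i) ^ 2) ^ 2 :=
  (contDiff_dphi hβ).comp ((contDiff_fst_apply j).sub (contDiff_fst_apply i))

/-- `x ↦ φ''(q_j - q_i)` is smooth (`β ≥ 0`). [folklore] -/
theorem contDiff_ddphi_coord (hβ : 0 ≤ β) (i j : Fin L) {n : WithTop ℕ∞} :
    ContDiff ℝ n fun x : PhaseSpace L =>
      6 * β * (9 * β * (x.1 j - x.1 i) ^ 2 - 1) / (1 + 3 * β * (x.1 j - x.1 i) ^ 2) ^ 3 :=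
  (contDiff_ddphi hβ).comp ((contDiff_fst_apply j).sub (contDiff_fst_apply i))

/-- **The bond term `A + B = p_i G + p_j G'` of the witness is smooth** (`β ≥ 0`). [folklore] -/
theorem contDiff_bond (hβ : 0 ≤ β) (i j : Fin L) :
    ContDiff ℝ ∞ fun x : PhaseSpace L =>
      x.2 i * (x.2 j ^ 2 * (-(6 * β * (x.1 j - x.1 i)) / (1 + 3 * β * (x.1 j - x.1 i) ^ 2) ^ 2) -
          partialQ j ((pinnedChain ω₂ lam β γ).hamiltonian L) x * (1 / (1 + 3 * β * (x.1 j - x.1 i) ^ 2))) +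
        x.2 j * (x.2 i ^ 2 * (-(6 * β * (x.1 j - x.1 i)) / (1 + 3 * β * (x.1 j - x.1 i) ^ 2) ^ 2) +
          partialQ i ((pinnedChain ω₂ lam β γ).hamiltonian L) x * (1 / (1 + 3 * β * (x.1 j - x.1 i) ^ 2))) :=
  ((contDiff_snd_apply i).mul ((((contDiff_snd_apply j).pow 2).mul (contDiff_dphi_coord hβ i j)).sub
    ((contDiff_partialQ_hamiltonian j).mul (contDiff_phi_coord hβ i j)))).add
    ((contDiff_snd_apply j).mul ((((contDiff_snd_apply i).pow 2).mul (contDiff_dphi_coord hβ i j)).add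
      ((contDiff_partialQ_hamiltonian i).mul (contDiff_phi_coord hβ i j))))

/-- The guarded bond term (zero off the bonds `j = i + 1`) is smooth (`β ≥ 0`). [folklore] -/
theorem contDiff_bond_ite (hβ : 0 ≤ β) (i j : Fin L) :
    ContDiff ℝ ∞ fun x : PhaseSpace L => if j.val = i.val + 1 then
      (x.2 i * (x.2 j ^ 2 * (-(6 * β * (x.1 j - x.1 i)) / (1 + 3 * β * (x.1 j - x.1 i) ^ 2) ^ 2) -
          partialQ j ((pinnedChain ω₂ lam β γ).hamiltonian L) x * (1 / (1 + 3 * β * (x.1 j - x.1 i) ^ 2))) +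
        x.2 j * (x.2 i ^ 2 * (-(6 * β * (x.1 j - x.1 i)) / (1 + 3 * β * (x.1 j - x.1 i) ^ 2) ^ 2) +
          partialQ i ((pinnedChain ω₂ lam β γ).hamiltonian L) x * (1 / (1 + 3 * β * (x.1 j - x.1 i) ^ 2))))
      else 0 := by
  by_cases h : j.val = i.val + 1
  · simp only [h, if_true]
    exact contDiff_bond hβ i j
  · simp only [h, if_false]
    exact contDiff_const

/-- **(d) The Thomson witness `v` is smooth** (`β ≥ 0`). [folklore] -/
theorem contDiff_thomsonWitness (hβ : 0 ≤ β) :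
    ContDiff ℝ ∞ fun x : PhaseSpace L => ∑ i : Fin L, ∑ j : Fin L, if j.val = i.val + 1 then
      (x.2 i * (x.2 j ^ 2 * (-(6 * β * (x.1 j - x.1 i)) / (1 + 3 * β * (x.1 j - x.1 i) ^ 2) ^ 2) -
          partialQ j ((pinnedChain ω₂ lam β γ).hamiltonian L) x * (1 / (1 + 3 * β * (x.1 j - x.1 i) ^ 2))) +
        x.2 j * (x.2 i ^ 2 * (-(6 * β * (x.1 j - x.1 i)) / (1 + 3 * β * (x.1 j - x.1 i) ^ 2) ^ 2) +
          partialQ i ((pinnedChain ω₂ lam β γ).hamiltonian L) x * (1 / (1 + 3 * β * (x.1 j - x.1 i) ^ 2))))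
      else 0 :=
  ContDiff.sum fun i _ => ContDiff.sum fun j _ => contDiff_bond_ite hβ i j

/-- The Thomson witness is `C²` (the regularity asked by the witness family). [folklore] -/
theorem contDiff_two_thomsonWitness (hβ : 0 ≤ β) :
    ContDiff ℝ 2 fun x : PhaseSpace L => ∑ i : Fin L, ∑ j : Fin L, if j.val = i.val + 1 then
      (x.2 i * (x.2 j ^ 2 * (-(6 * β * (x.1 j - x.1 i)) / (1 + 3 * β * (x.1 j - x.1 i) ^ 2) ^ 2) -
          partialQ j ((pinnedChain ω₂ lam β γ).hamiltonian L) x * (1 / (1 + 3 * β * (x.1 j - x.1 i) ^ 2))) +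
        x.2 j * (x.2 i ^ 2 * (-(6 * β * (x.1 j - x.1 i)) / (1 + 3 * β * (x.1 j - x.1 i) ^ 2) ^ 2) +
          partialQ i ((pinnedChain ω₂ lam β γ).hamiltonian L) x * (1 / (1 + 3 * β * (x.1 j - x.1 i) ^ 2))))
      else 0 :=
  contDiff_infty.1 (contDiff_thomsonWitness hβ) 2

/-! ### Registered helper -/

/-- Registered helper sub-goal `helper_thomsonWitnessContDiffTwo` of crux stmt-AtomisticToContinuum-11977 (line
`abel-storage-decay`, stub B `stub_bulkAbelGKPositivity`): the Thomson witness is `C²` for `β ≥ 0`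
(`contDiff_two_thomsonWitness`, restated notation-free). [folklore] -/
theorem helper_thomsonWitnessContDiffTwo : ∀ (ω₂ lam β γ : ℝ), 0 ≤ β → ∀ (L : ℕ), ContDiff ℝ 2 (fun x : Literature.MathematicalPhysics.KineticTheory.HeatConduction.PhaseSpace L => ∑ i : Fin L, ∑ j : Fin L, if j.val = i.val + 1 then (x.2 i * (x.2 j ^ 2 * (-(6 * β * (x.1 j - x.1 i)) / (1 + 3 * β * (x.1 j - x.1 i) ^ 2) ^ 2) - Literature.MathematicalPhysics.KineticTheory.HeatConduction.partialQ j ((Literature.MathematicalPhysics.KineticTheory.HeatConduction.pinnedChain ω₂ lam β γ).hamiltonian L) x * (1 / (1 + 3 * β * (x.1 j - x.1 i) ^ 2))) + x.2 j * (x.2 i ^ 2 * (-(6 * β * (x.1 j - x.1 i)) / (1 + 3 * β * (x.1 j - x.1 i) ^ 2) ^ 2) + Literature.MathematicalPhysics.KineticTheory.HeatConduction.partialQ i ((Literature.MathematicalPhysics.KineticTheory.HeatConduction.pinnedChain ω₂ lam β γ).hamiltonian L) x * (1 / (1 + 3 * β * (x.1 j - x.1 i) ^ 2)))) else 0) :=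
  fun _ _ _ _ hβ _ => contDiff_two_thomsonWitness hβ

end Summit.AtomisticToContinuum.FouriersLaw.Theorems.NoisyFourier.ThomsonWitness.Algebra

end
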